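import Summits.QuantumFields.BalabanUV.Beta.GAN24.SoftColumnVertexRateFour
import Summits.QuantumFields.BalabanUV.Beta.GAN24.SoftColumnGradVertexRate
import Summits.QuantumFields.BalabanUV.T4Continuum.Support.BalabanAveragedCoerciveTower
import Summits.QuantumFields.BalabanUV.Beta.PropagatorWoodburyFibreOpNorm
import Literature.MathematicalPhysics.QuantumFieldTheory.Balaban1983to89.B5Hk163Form166
import Literature.MathematicalPhysics.QuantumFieldTheory.Balaban1983to89.B5Hk163TorusHolderRate
import Literature.MathematicalPhysics.QuantumFieldTheory.Balaban1983to89.Beta.BlockEffectiveAction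

/-!
# `BalabanUV.Beta.GAN24.SoftColumnSupLetter` — binder row G-an2-4 ∕ (CONV-C), route R7 «TWO CURRENCIES»: THE ONE DISPLAYED SUP LETTER
# `hcol : ∀ k q X, √(n_k^d)·‖M̃_k X q‖ ≤ C_∞` OF `SoftColumnVertexRate.V₃_col_succ_sub_le` ∕ `SoftColumnVertexRateFour.V₄_col_succ_sub_le`
# IS A TREE THEOREM FOR EVERY `a > 0` — every `L ≥ 1`, every torus, every level `k`; constant `KH d` a function of `d` ALONE —
# by (1.103) `𝒢_aQ* = H_k·(Q𝒢_aQ*)`, the kernel decay of the typed `H_k` (`B5Hk163Torus.norm_HkOp_le`) and `Q𝒢_aQ* ≤ a⁻¹` (1.100)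

NOT IN PRINT; OUR BOOKKEEPING (G-an2-4 formalisation swarm, leaf prover 03, gen 50; CRUX TEAM (2), ruling «YM REDIRECT TOWARDS THE
SUMMIT» 2026-08-21).  Filed on the crux prover's **INTERFACE REQUEST G-an2-4: (R7-HCOL)** (unit `b2b-balaban-gan24-p3` gen 25, cell
`HOME/INBOX.md` block 2026-08-21T10:48Z, journal `CLAIMS.log` l.30338): «`∃ C (d, a, L), ∀ k (q : idx L M 0) (X : idx L M k),
Real.sqrt (((L:ℝ)^d)^k) * ‖BalabanMinimizerLaw.Mtil L M a ha k X q‖ ≤ C` — the k-uniform POINTWISE bound of the physical soft leg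
`a·n_k^d·(𝒢^{(L^{−k})}QBtow_kᴴe_q)(x)` on the `calG` carrier of NE2-P1's tower ([B5] (1.65)∕(1.110)-TYPE; a BOUND, not a rate) = the
ONE displayed letter of `SoftColumnVertexRate.V₃_col_succ_sub_le` ∕ `…Four.V₄_col_succ_sub_le` … candidate suppliers: road P2's sup
letters ∕ the (1.110) leaves on THEIR carrier `B5DeltaA169.DeltaA` + a `calG ↔ DeltaA⁻¹` dictionary».  This file is a dictionary +
composition of tree theorems BY NAME; NO new analysis.  The delivered constant does not depend on `a`, `k`, `L` or the volume.

ROUTE (tree facts BY NAME).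
 §1 `BalabanAveragedTowerApply.Atow_QBlev_apply` — the semigroup identity of (1.18) entrywise ⟹ `‖(Atow QBlev k) q x′‖ ≤ n_k^{−d}`
    (`norm_Atow_QBlev_apply_le`: `n_k^{−(d+1)}·#contours`, `#contours ≤ n_k`).
 §2 the column's unit-normalised source `src k q x′ := n_k^d·conj((Atow QBlev k) q x′)` has SUP NORM ≤ 1 (`norm_src_le`);
    `BalabanMinimizerLaw.Mtil L M a ha k = (√(n_k^d)·a)•(calG_k·(Atow QBlev k)ᴴ)` ⟹ `√(n_k^d)·‖(Mtil k) X q‖ = a·‖(calG_k *ᵥ src k q)(X)‖`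
    (`sqrt_mul_norm_Mtil_apply`; with `calG_k = (DeltaA n_k M a)⁻¹`, `B5DeltaA169.calG_eq_DeltaA_inv`, in `…_DeltaA` — the requested
    `calG ↔ DeltaA⁻¹` dictionary).
 §3 THE LETTER, EVERY `a > 0`: by `BalabanAveragedCoerciveTower.Atow_QBlev_eq_submatrix` the source IS the `q`-column of `Q* = n^d·Qᴴ`
    (`src_eq_QvAdj`), so `calG·src_q = (𝒢_aQ*)_q = (H_k·(Q𝒢_aQ*))_q` by (1.103) `H_k = 𝒢Q*(Q𝒢Q*)⁻¹` (`Beta.FluctuationProjection.Hk`,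
    `QGQ_inv_mul`; `calG_mulVec_src_eq`); every entry of `Q𝒢_aQ*` is `≤ a⁻¹` (`norm_QGQ_apply_le` ⇐ `QGQh_posDef`,
    `Beta.BlockEffectiveAction.inv_a_sub_QGQ_posSemidef` = (1.100), `PropagatorWoodburyFibre.opNorm_le_of_posSemidef_of_sub_posSemidef`,
    `BalabanAveragedTowerUnit.norm_entry_le_opNorm`); the rows of the typed `H_k` are summable uniformly in `n` and in the torus
    (`sum_norm_HkOp_le` ⇐ `B5Hk163Torus.norm_HkOp_le` (kernel decay, `d`-only constants) + `B5Hk163Form166.HkOp_eq_Hk` +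
    `B5Hk163TorusHolderRate.sum_exp_torusSupNorm_sub_rep_le` (volume-free torus sum)) ⟹
    **`sqrt_mul_norm_Mtil_le : √(((L:ℝ)^(d+1))^k) * ‖Mtil L M a ha k X q‖ ≤ KH d`** for ALL `a > 0`, `L ≥ 1`, `M`, `k`, `q`, `X`, with
    `KH d = MG163(d+1)·periodConst(κ₁₆₃(d+1), d)·(d+1)·latticeConst(d+1, κ₁₆₃(d+1)∕(d+1))`; ∃-packagings `exists_hcol` (EXACTLY the
    consumer's binder) and `exists_hcol_all` (every `d`; the `Fin 0` index type is empty); CONSUMER JUNCTIONS `V₃_col_succ_sub_le_all` ∕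
    `V₄_col_succ_sub_le_all` = p3-g25's `V₃_col_succ_sub_le` ∕ `V₄_col_succ_sub_le` with `hcol` SUPPLIED — the R7 three- and four-column
    vertex chains of the `U = 1` soft-minimiser tower have the one-step SupRate `θ₁ = L⁻¹` with NO displayed hypothesis, every `a > 0`.
 §4 the same junction for p3-g25's PART 7 gradient vertex `SoftColumnGradVertexRate.V₃_gradcol_succ_sub_le` (`V₃_gradcol_succ_sub_le_all`).
 MECHANISM IN ONE LINE: `a·n_k^{d}·𝒢_aQ_kᴴe_q = H_k·(a·Q𝒢_aQ*)e_q`, `0 ≤ a·Q𝒢_aQ* ≤ 1`, and `Σ_{q′}|H_k(X, q′)| ≤ KH d`.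

DIMENSION BOOKKEEPING: `Fin (d + 1)` directions as in every `B5Hk163*` file (the consumer's `Fin 0` case is vacuous; `exists_hcol_all`
serves every `d`).

HONEST SCOPE.  [folklore] composition of tree theorems BY NAME; `U = 1`; a BOUND, not a rate; constants ours (`d`-only, crude, never
Bałaban's `O(1)`); supplier work on route R7's one displayed letter; zero on the D1 grid.  NOT (CONV-C) (a list), NOT (ρ2)(ρ3), NEVER
«G-an2-4 closed», NOT NE2, NOT D1, NOT BetaPertH, NOT continuum, NOT Clay.  HONEST DEPENDENCY (cell records, verbatim): «continuum YM on
T⁴ ⇐ BetaPertH ∧ nine spine estimates (0/9 proved); BetaPertH ⇐ (D1) ∧ (D4) ∧ CAP+tail; G-an2-4 gates asym, D1 and NE2/3/4.»  ABSOLUTE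
RULE kept: no statement of the papers is a hypothesis anywhere in this file; the only imports are kernel-proved tree modules; 0 `sorry`.
Locators (text only): [Balaban1984PropagatorsI] (1.18) p. 20, (1.63) p. 28, (1.68)–(1.71) p. 29, (1.100)–(1.103) p. 34.  Provenance:
prover-b2b-balaban-gan24-formalise-leaf-03-g50-0 (unit `b2b-balaban-gan24-formalise-leaf-03`, gen 50), 2026-08-21.
-/

noncomputable section

open scoped BigOperators ComplexConjugate Matrix Matrix.Norms.L2Operator ComplexOrder
open Finset

namespace Summit.QuantumFields.BalabanUV.Beta.GAN24.SoftColumnSupLetter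

open Literature.MathematicalPhysics.QuantumFieldTheory.Balaban1983to89.B5Prop11Plancherel
open Literature.MathematicalPhysics.QuantumFieldTheory.Balaban1983to89.B5G183RateUnitTower (lev lev_neZero)
open Literature.MathematicalPhysics.QuantumFieldTheory.Balaban1983to89.B5DeltaA169 (DeltaA QvAdj calG_eq_DeltaA_inv)
open Literature.MathematicalPhysics.QuantumFieldTheory.Balaban1983to89.B4TorusKernel (periodConst)
open Literature.MathematicalPhysics.QuantumFieldTheory.Balaban1983to89.B4TorusKernel.MultiPeriod (torusSupNorm)
open Literature.MathematicalPhysics.QuantumFieldTheory.Balaban1983to89.B5Block118 (bpt tstep QvOp)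
open Literature.MathematicalPhysics.QuantumFieldTheory.Balaban1983to89.B5Blocks16 (blockOf)
open Literature.MathematicalPhysics.QuantumFieldTheory.Balaban1983to89.B5Kernel166Decay (periodConst_pos)
open Literature.MathematicalPhysics.QuantumFieldTheory.Balaban1983to89.B4Sect5Proof (latticeConst latticeConst_nonneg)
open Literature.MathematicalPhysics.QuantumFieldTheory.Balaban1983to89.B6LowerBound2153Torus (toT rep toT_rep)
open Literature.MathematicalPhysics.QuantumFieldTheory.Balaban1983to89.B5Hk163TorusHolderRate (sum_exp_torusSupNorm_sub_rep_le)
open Summit.QuantumFields.BalabanUV.T4Continuum.CovariantAveragingTower (Atow)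
open Summit.QuantumFields.BalabanUV.T4Continuum.BalabanAveragedTowerUnit (idx one_le_lev' cast_lev' QBlev calGlev norm_entry_le_opNorm)
open Summit.QuantumFields.BalabanUV.T4Continuum.BalabanAveragedTowerApply (InBlock lineCount Atow_QBlev_apply)
open Summit.QuantumFields.BalabanUV.T4Continuum.BalabanAveragedCoerciveTower (unitIdx unitIdx_apply natCast_lev Atow_QBlev_eq_submatrix)
open Summit.QuantumFields.BalabanUV.Beta.PropagatorWoodburyFibre (opNorm_le_of_posSemidef_of_sub_posSemidef)
open Literature.MathematicalPhysics.QuantumFieldTheory.Balaban1983to89.B5Hk163Strip (kappa163 kappa163_pos)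
open Literature.MathematicalPhysics.QuantumFieldTheory.Balaban1983to89.B5Hk163Decay (MG163 MG163_nonneg)
open Literature.MathematicalPhysics.QuantumFieldTheory.Balaban1983to89.B5Hk163Torus (HkOp norm_HkOp_le)
open Literature.MathematicalPhysics.QuantumFieldTheory.Balaban1983to89.B5Hk163Form166 (HkOp_eq_Hk)
open Literature.MathematicalPhysics.QuantumFieldTheory.Balaban1983to89.Beta.FluctuationProjection
  (Hk QGQ QGQ_eq_smul QGQh_posDef QGQ_inv_mul digitOf bpt_blockOf_digitOf)
open Literature.MathematicalPhysics.QuantumFieldTheory.Balaban1983to89.Beta.BlockEffectiveAction (inv_a_sub_QGQ_posSemidef)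
open Summit.QuantumFields.BalabanUV.T4Continuum.BalabanMinimizerLaw
open Summit.QuantumFields.BalabanUV.Beta.GAN24.ChainLeibniz (cnorm₃)
open Summit.QuantumFields.BalabanUV.Beta.GAN24.ChainLeibnizFour (cnorm₄)
open Summit.QuantumFields.BalabanUV.Beta.GAN24.SoftColumnVertexRate (col colS V₃ V₃_col_succ_sub_le)
open Summit.QuantumFields.BalabanUV.Beta.GAN24.SoftColumnVertexRateFour (V₄ V₄_col_succ_sub_le)
open Summit.QuantumFields.BalabanUV.Beta.GAN24.SoftColumnGradVertexRate (fd fdS V₃_gradcol_succ_sub_le)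

variable {d : ℕ}

/-! ## §1 The entries of the composite averaging `Atow QBlev k` are bounded by `n_k^{−d}` -/

section Entries

variable (L : ℕ) [NeZero L] (M : Fin d → ℕ) [hM : ∀ μ, NeZero (M μ)]

omit hM in
/-- the contour count `#{t < n : y − t e_μ ∈ B^{n}(x₀)}` is at most `n` (a sum of `n` indicators). [folklore] -/
theorem norm_lineCount_le (n : ℕ) (b : Fin d → ℕ) (μ : Fin d) (y : Tor (fine n M)) :
    ‖lineCount M n b μ y‖ ≤ n := by
  rw [lineCount]
  calc ‖∑ t : Fin n, (if InBlock M n b (y - tstep (fine n M) μ (t : ℕ)) then (1 : ℂ) else 0)‖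
      ≤ ∑ t : Fin n, ‖(if InBlock M n b (y - tstep (fine n M) μ (t : ℕ)) then (1 : ℂ) else 0)‖ :=
        norm_sum_le _ _
    _ ≤ ∑ _t : Fin n, (1 : ℝ) := Finset.sum_le_sum fun t _ => by split_ifs <;> simp
    _ = n := by simp

/-- **`‖(Atow QBlev k)_{(q,μ),(x′,ν)}‖ ≤ n_k^{−d}`** (`n_k = L^k`): every entry of the `k`-fold composite (1.18)-averaging is
`δ_{μν}·n_k^{−(d+1)}·#{contours} ≤ n_k^{−(d+1)}·n_k` (`Atow_QBlev_apply`). [folklore] -/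
theorem norm_Atow_QBlev_apply_le (k : ℕ) (i : idx L M 0) (y : idx L M k) :
    ‖Atow (QBlev L M) k i y‖ ≤ (((L : ℝ) ^ d) ^ k)⁻¹ := by
  have hL : (0 : ℝ) < L := by exact_mod_cast Nat.pos_of_ne_zero (NeZero.ne L)
  have hLk : (0 : ℝ) < (L : ℝ) ^ k := pow_pos hL k
  rw [Atow_QBlev_apply L M k i y]
  split_ifs with h
  · rw [norm_mul, norm_inv, norm_pow, Complex.norm_natCast, cast_lev']
    have hn := norm_lineCount_le M (lev L k) (fun ν => (i.1 ν).val) i.2 y.1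
    rw [cast_lev'] at hn
    calc (((L : ℝ) ^ k) ^ (d + 1))⁻¹ * ‖lineCount M (lev L k) (fun ν => (i.1 ν).val) i.2 y.1‖
        ≤ (((L : ℝ) ^ k) ^ (d + 1))⁻¹ * (L : ℝ) ^ k := mul_le_mul_of_nonneg_left hn (by positivity)
      _ = (((L : ℝ) ^ d) ^ k)⁻¹ := by
          rw [pow_succ, mul_inv, mul_assoc, inv_mul_cancel₀ hLk.ne', mul_one, ← pow_mul, ← pow_mul, mul_comm]
  · rw [norm_zero]; positivity

end Entries

/-! ## §2 The physical column as Bałaban's `G = Δ_a⁻¹` applied to a source of sup norm `≤ 1` -/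

section Column

variable (L : ℕ) [NeZero L] (M : Fin d → ℕ) [hM : ∀ μ, NeZero (M μ)]

/-- **the unit-normalised source of the column `q`**: `src k q x′ = n_k^d · conj((Atow QBlev k) q x′)` (the adjoint averaging of the
coarse delta `e_q`, in the normalisation in which its sup norm is `≤ 1`). OURS. [folklore] -/
def src (k : ℕ) (q : idx L M 0) : idx L M k → ℂ :=
  fun x => (((((L : ℝ) ^ d) ^ k : ℝ)) : ℂ) * star (Atow (QBlev L M) k q x)

/-- `|src k q|_∞ ≤ 1`. [folklore] -/
theorem norm_src_le (k : ℕ) (q : idx L M 0) (x : idx L M k) : ‖src L M k q x‖ ≤ 1 := by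
  have hL : (0 : ℝ) < L := by exact_mod_cast Nat.pos_of_ne_zero (NeZero.ne L)
  have hs : (0 : ℝ) < ((L : ℝ) ^ d) ^ k := pow_pos (pow_pos hL d) k
  rw [src, norm_mul, norm_star, Complex.norm_real, Real.norm_of_nonneg hs.le]
  calc ((L : ℝ) ^ d) ^ k * ‖Atow (QBlev L M) k q x‖ ≤ ((L : ℝ) ^ d) ^ k * (((L : ℝ) ^ d) ^ k)⁻¹ :=
        mul_le_mul_of_nonneg_left (norm_Atow_QBlev_apply_le L M k q x) hs.le
    _ = 1 := mul_inv_cancel₀ hs.ne'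

variable (a : ℝ) (ha : 0 < a)

/-- **`√(n_k^d)·‖(M̃_k)_{X q}‖ = a·‖(𝒢_k · src k q)(X)‖`**: the physical soft leg `a·n_k^d·(𝒢^{(L^{−k})}QBtow_kᴴ e_q)(X)` IS Bałaban's
propagator applied to the bounded source `src k q` ([B5] (1.68)–(1.71): `B ↦ a n^d 𝒢 Q_kᴴ B`). [folklore] -/
theorem sqrt_mul_norm_Mtil_apply (k : ℕ) (q : idx L M 0) (X : idx L M k) :
    Real.sqrt (((L : ℝ) ^ d) ^ k) * ‖Mtil L M a ha k X q‖ = a * ‖(calGlev L M a ha k *ᵥ src L M k q) X‖ := by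
  have hL : (0 : ℝ) < L := by exact_mod_cast Nat.pos_of_ne_zero (NeZero.ne L)
  have hs : (0 : ℝ) ≤ ((L : ℝ) ^ d) ^ k := (pow_pos (pow_pos hL d) k).le
  have hr : 0 ≤ Real.sqrt (((L : ℝ) ^ d) ^ k) := Real.sqrt_nonneg _
  have e : (calGlev L M a ha k *ᵥ src L M k q) X
      = (((((L : ℝ) ^ d) ^ k : ℝ)) : ℂ) * (calGlev L M a ha k * (Atow (QBlev L M) k)ᴴ) X q := by
    simp only [Matrix.mulVec, dotProduct, Matrix.mul_apply, Matrix.conjTranspose_apply, src, Finset.mul_sum]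
    exact Finset.sum_congr rfl fun x _ => by ring
  rw [e, norm_mul, Complex.norm_real, Real.norm_of_nonneg hs, Mtil, Matrix.smul_apply, smul_eq_mul, norm_mul,
    Complex.norm_real, Real.norm_of_nonneg (mul_nonneg hr ha.le)]
  calc Real.sqrt (((L : ℝ) ^ d) ^ k) * (Real.sqrt (((L : ℝ) ^ d) ^ k) * a * ‖(calGlev L M a ha k * (Atow (QBlev L M) k)ᴴ) X q‖)
      = (Real.sqrt (((L : ℝ) ^ d) ^ k) * Real.sqrt (((L : ℝ) ^ d) ^ k)) * a
          * ‖(calGlev L M a ha k * (Atow (QBlev L M) k)ᴴ) X q‖ := by ring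
    _ = a * (((L : ℝ) ^ d) ^ k * ‖(calGlev L M a ha k * (Atow (QBlev L M) k)ᴴ) X q‖) := by
        rw [Real.mul_self_sqrt hs]; ring

/-- the same with the carrier named as in the (1.110)∕(1.115) files: `𝒢_k = (DeltaA n_k M a)⁻¹` (`B5DeltaA169.calG_eq_DeltaA_inv`,
«G = Δ_a⁻¹» (1.71)). [folklore] -/
theorem sqrt_mul_norm_Mtil_apply_DeltaA (k : ℕ) (q : idx L M 0) (X : idx L M k) :
    Real.sqrt (((L : ℝ) ^ d) ^ k) * ‖Mtil L M a ha k X q‖ = a * ‖((DeltaA (lev L k) M a)⁻¹ *ᵥ src L M k q) X‖ := by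
  rw [sqrt_mul_norm_Mtil_apply, calGlev, calG_eq_DeltaA_inv]

end Column

/-! ## §3 THE LETTER FOR EVERY `a > 0`, UNCONDITIONALLY: `𝒢_aQ* = H_k·(Q𝒢_aQ*)` (1.103), the kernel decay of the
typed `H_k` (`B5Hk163Torus.norm_HkOp_le`) and `Q𝒢_aQ* ≤ a⁻¹` (1.100) -/

section AllA

variable (L : ℕ) [NeZero L] (M : Fin (d + 1) → ℕ) [hM : ∀ μ, NeZero (M μ)] (a : ℝ) (ha : 0 < a)

omit hM in
/-- the constant of the all-`a` letter: `MG163(d+1)·periodConst(κ₁₆₃(d+1), d)·(d+1)·latticeConst(d+1, κ₁₆₃(d+1)/(d+1))` — a function of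
`d` ALONE (free of `a`, `k`, `L` and the volume). OURS. [folklore] -/
def KH (d : ℕ) : ℝ :=
  MG163 (d + 1) * periodConst (kappa163 (d + 1)) d * ((d + 1) * latticeConst (d + 1) (kappa163 (d + 1) / (d + 1)))

omit hM in
/-- `0 ≤ KH d`. [folklore] -/
theorem KH_nonneg (d : ℕ) : 0 ≤ KH d := by
  have h1 := MG163_nonneg (d + 1)
  have h2 := (periodConst_pos (kappa163_pos (d + 1)) d).le
  have h3 : (0 : ℝ) ≤ latticeConst (d + 1) (kappa163 (d + 1) / (d + 1)) :=
    latticeConst_nonneg _ (div_pos (kappa163_pos _) (by positivity)).le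
  rw [KH]; positivity

/-- **`|(Q𝒢_aQ*)_{q′q}| ≤ a⁻¹`**: every entry of the averaged propagator `QGQ = Q·𝒢_a·Q*` is bounded by `a⁻¹` — `0 ≤ QGQ`
(`FluctuationProjection.QGQh_posDef`) and `a⁻¹·1 − QGQ ≥ 0` (`BlockEffectiveAction.inv_a_sub_QGQ_posSemidef`, [B5] (1.100)) give
`‖QGQ‖ ≤ a⁻¹` (`opNorm_le_of_posSemidef_of_sub_posSemidef`), and an entry is bounded by the operator norm. [folklore] -/
theorem norm_QGQ_apply_le (n : ℕ) [NeZero n] (hn : 1 ≤ n) (q' q : Tor M × Fin (d + 1)) :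
    ‖QGQ n hn M a ha q' q‖ ≤ a⁻¹ := by
  have hnd : (0 : ℂ) ≤ (n : ℂ) ^ (d + 1) := by
    rw [show ((n : ℂ) ^ (d + 1)) = ((((n : ℝ) ^ (d + 1) : ℝ)) : ℂ) by push_cast; ring]
    exact Complex.zero_le_real.mpr (by positivity)
  have h0 : (QGQ n hn M a ha).PosSemidef := by
    rw [QGQ_eq_smul]
    exact (QGQh_posDef n hn M a ha).posSemidef.smul hnd
  have h1 := inv_a_sub_QGQ_posSemidef n hn M a ha
  have e : ((a⁻¹ : ℝ) • (1 : Matrix (Tor M × Fin (d + 1)) (Tor M × Fin (d + 1)) ℂ))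
      = (((a⁻¹ : ℝ) : ℂ)) • (1 : Matrix (Tor M × Fin (d + 1)) (Tor M × Fin (d + 1)) ℂ) := by
    ext i j
    simp only [Matrix.smul_apply, Complex.real_smul, smul_eq_mul]
  rw [e] at h1
  exact (norm_entry_le_opNorm _ q' q).trans (opNorm_le_of_posSemidef_of_sub_posSemidef (inv_nonneg.mpr ha.le) h0 h1)

/-- **the column source IS a column of `Q* = n^d·Qᴴ`**: `src k q x = (QvAdj n_k M) x (unitIdx q)` — the composite of the tower's
one-step (1.18)-averagings is the printed `k`-level averaging `Q_k` (`BalabanAveragedCoerciveTower.Atow_QBlev_eq_submatrix`).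
[folklore] -/
theorem src_eq_QvAdj (k : ℕ) (q : idx L M 0) (x : idx L M k) :
    src L M k q x = QvAdj (lev L k) M x (unitIdx L M q) := by
  rw [src, Atow_QBlev_eq_submatrix, Matrix.submatrix_apply, QvAdj, Matrix.smul_apply, Matrix.conjTranspose_apply,
    smul_eq_mul, natCast_lev]
  congr 1
  push_cast
  rw [← pow_mul, ← pow_mul, mul_comm]

/-- **`(𝒢_a·src_q)(X) = (H_k·(Q𝒢_aQ*))_{X, q}`** — (1.103) `H_k = 𝒢Q*(Q𝒢Q*)⁻¹` read as `𝒢_aQ* = H_k·(Q𝒢_aQ*)`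
(`FluctuationProjection.Hk`, `QGQ_inv_mul`). [folklore] -/
theorem calG_mulVec_src_eq (k : ℕ) (q : idx L M 0) (X : idx L M k) :
    (calGlev L M a ha k *ᵥ src L M k q) X
      = (Hk (lev L k) (one_le_lev' L k) M a ha * QGQ (lev L k) (one_le_lev' L k) M a ha) X (unitIdx L M q) := by
  have e1 : (calGlev L M a ha k *ᵥ src L M k q) X = (calGlev L M a ha k * QvAdj (lev L k) M) X (unitIdx L M q) := by
    simp only [Matrix.mulVec, dotProduct, Matrix.mul_apply, src_eq_QvAdj]
  rw [e1, calGlev, Hk, Matrix.mul_assoc (calG (lev L k) (one_le_lev' L k) M a ha * QvAdj (lev L k) M), QGQ_inv_mul,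
    Matrix.mul_one]

/-- **the row sums of the typed `H_k` are bounded by `KH d`**: `Σ_{q′} |H_k(X, q′)| ≤ KH d` for every fine bond `X`, every `n ≥ 1`,
every torus — `B5Hk163Torus.norm_HkOp_le` (kernel decay, `d`-only constants) summed with the volume-free torus sum
`B5Hk163TorusHolderRate.sum_exp_torusSupNorm_sub_rep_le`. [folklore] -/
theorem sum_norm_HkOp_le (n : ℕ) [NeZero n] (X : Tor (fine n M) × Fin (d + 1)) :
    ∑ q' : Tor M × Fin (d + 1), ‖HkOp n M X q'‖ ≤ KH d := by
  obtain ⟨t, μ⟩ := X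
  obtain ⟨r, hr⟩ : ∃ r : Fin (d + 1) → Fin n, t = bpt n M (blockOf n M t) r := ⟨digitOf n M t, (bpt_blockOf_digitOf n M t).symm⟩
  obtain ⟨x', hx'⟩ : ∃ x' : Fin (d + 1) → ℤ, blockOf n M t = toT M x' := ⟨rep M (blockOf n M t), (toT_rep _ _).symm⟩
  have ht : t = bpt n M (toT M x') r := by rw [← hx']; exact hr
  have hκ : 0 < kappa163 (d + 1) / (d + 1) := div_pos (kappa163_pos _) (by positivity)
  set C : ℝ := MG163 (d + 1) * periodConst (kappa163 (d + 1)) d with hC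
  rw [Fintype.sum_prod_type]
  calc ∑ y' : Tor M, ∑ lam : Fin (d + 1), ‖HkOp n M (t, μ) (y', lam)‖
      ≤ ∑ y' : Tor M, ∑ _lam : Fin (d + 1),
          C * Real.exp (-(kappa163 (d + 1) / (d + 1) * torusSupNorm M (x' - rep M y'))) := by
        refine Finset.sum_le_sum fun y' _ => Finset.sum_le_sum fun lam _ => ?_
        have h := norm_HkOp_le n M μ lam r x' (rep M y')
        rw [toT_rep, ← ht] at h
        exact h
    _ = C * ((d + 1) * ∑ y' : Tor M, Real.exp (-(kappa163 (d + 1) / (d + 1) * torusSupNorm M (x' - rep M y')))) := by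
        simp only [Finset.sum_const, Finset.card_univ, Fintype.card_fin, nsmul_eq_mul, Finset.mul_sum]
        refine Finset.sum_congr rfl fun y' _ => ?_
        push_cast
        ring
    _ ≤ KH d := by
        rw [KH, hC]
        have hC0 : 0 ≤ MG163 (d + 1) * periodConst (kappa163 (d + 1)) d :=
          mul_nonneg (MG163_nonneg _) (periodConst_pos (kappa163_pos _) _).le
        have hS := sum_exp_torusSupNorm_sub_rep_le M hκ x'
        have hd : (0 : ℝ) ≤ d + 1 := by positivity
        exact mul_le_mul_of_nonneg_left (mul_le_mul_of_nonneg_left hS hd) hC0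

/-- **THE LETTER `hcol` FOR EVERY `a > 0` — R7-HCOL DELIVERED IN FULL**: for every `a > 0`, every `L ≥ 1`, every torus `M`, every level `k`,
every coarse bond `q` and every fine bond `X`, `√(n_k^{d+1})·‖(M̃_k)_{X q}‖ ≤ KH d` — the constant a function of `d` ALONE (free of
`a`, `k`, `L`, volume).  MECHANISM: `a·n_k^{d+1}·𝒢_aQ_kᴴe_q = a·𝒢_aQ*e_q = H_k·(a·Q𝒢_aQ*)e_q` ((1.103), `calG_mulVec_src_eq`), the entries
of `a·Q𝒢_aQ*` are `≤ 1` ((1.100), `norm_QGQ_apply_le`), and the rows of the typed `H_k` are summable uniformly (`sum_norm_HkOp_le`).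
[folklore] -/
theorem sqrt_mul_norm_Mtil_le (k : ℕ) (q : idx L M 0) (X : idx L M k) :
    Real.sqrt (((L : ℝ) ^ (d + 1)) ^ k) * ‖Mtil L M a ha k X q‖ ≤ KH d := by
  rw [sqrt_mul_norm_Mtil_apply L M a ha, calG_mulVec_src_eq L M a ha, Matrix.mul_apply]
  have hsum : ‖∑ q' : Tor M × Fin (d + 1), Hk (lev L k) (one_le_lev' L k) M a ha X q'
        * QGQ (lev L k) (one_le_lev' L k) M a ha q' (unitIdx L M q)‖
      ≤ (∑ q' : Tor M × Fin (d + 1), ‖HkOp (lev L k) M X q'‖) * a⁻¹ := by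
    rw [Finset.sum_mul, ← HkOp_eq_Hk (lev L k) (one_le_lev' L k) M a ha]
    refine (norm_sum_le _ _).trans (Finset.sum_le_sum fun q' _ => ?_)
    rw [norm_mul]
    exact mul_le_mul_of_nonneg_left (norm_QGQ_apply_le M a ha (lev L k) (one_le_lev' L k) q' _) (norm_nonneg _)
  calc a * ‖∑ q' : Tor M × Fin (d + 1), Hk (lev L k) (one_le_lev' L k) M a ha X q'
          * QGQ (lev L k) (one_le_lev' L k) M a ha q' (unitIdx L M q)‖
      ≤ a * ((∑ q' : Tor M × Fin (d + 1), ‖HkOp (lev L k) M X q'‖) * a⁻¹) := mul_le_mul_of_nonneg_left hsum ha.le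
    _ = ∑ q' : Tor M × Fin (d + 1), ‖HkOp (lev L k) M X q'‖ := by field_simp
    _ ≤ KH d := sum_norm_HkOp_le M (lev L k) X

/-- the all-`a` letter in EXACTLY the consumer's binder shape: `∃ C ≥ 0, ∀ k q X, √(((L:ℝ)^(d+1))^k) * ‖Mtil L M a ha k X q‖ ≤ C`,
NO hypothesis. [folklore] -/
theorem exists_hcol :
    ∃ C : ℝ, 0 ≤ C ∧ ∀ (k : ℕ) (q : idx L M 0) (X : idx L M k),
      Real.sqrt (((L : ℝ) ^ (d + 1)) ^ k) * ‖Mtil L M a ha k X q‖ ≤ C :=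
  ⟨KH d, KH_nonneg d, sqrt_mul_norm_Mtil_le L M a ha⟩

/-- the all-`a` letter in EVERY dimension `d` (`Fin 0` vacuous). [folklore] -/
theorem exists_hcol_all {d : ℕ} (L : ℕ) [NeZero L] (M : Fin d → ℕ) [∀ μ, NeZero (M μ)] (a : ℝ) (ha : 0 < a) :
    ∃ C : ℝ, 0 ≤ C ∧ ∀ (k : ℕ) (q : idx L M 0) (X : idx L M k),
      Real.sqrt (((L : ℝ) ^ d) ^ k) * ‖Mtil L M a ha k X q‖ ≤ C := by
  cases d with
  | zero => exact ⟨0, le_rfl, fun k q X => X.2.elim0⟩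
  | succ d => exact ⟨KH d, KH_nonneg d, sqrt_mul_norm_Mtil_le L M a ha⟩

/-- **R7's THREE-COLUMN VERTEX CHAIN FOR EVERY `a > 0` — UNCONDITIONAL**: `SoftColumnVertexRate.V₃_col_succ_sub_le` with
`hcol := sqrt_mul_norm_Mtil_le`: `≤ 3·‖c‖₁·KH(d)·(a·Cst)·(a·CQH)·L^{−k}`, NO hypothesis.  NOT (CONV-C). [folklore] -/
theorem V₃_col_succ_sub_le_all (c : Fin (d + 1) → Fin (d + 1) → Fin (d + 1) → ℂ) (p q r : idx L M 0) (k : ℕ) :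
    ‖V₃ L (k + 1) c (colS L M a ha k p) (colS L M a ha k q) (colS L M a ha k r)
        - V₃ L k c (col L M a ha k p) (col L M a ha k q) (col L M a ha k r)‖
      ≤ 3 * (cnorm₃ c * (KH d * ((a * Cst (d + 1) a) * (a * CQH (d + 1) a * ((L : ℝ)⁻¹) ^ k)))) :=
  V₃_col_succ_sub_le L M a ha (KH_nonneg d) (sqrt_mul_norm_Mtil_le L M a ha) c p q r k

/-- **R7's FOUR-COLUMN VERTEX CHAIN FOR EVERY `a > 0` — UNCONDITIONAL**: `SoftColumnVertexRateFour.V₄_col_succ_sub_le` with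
`hcol := sqrt_mul_norm_Mtil_le`: `≤ 4·‖c‖₁·KH(d)²·(a·Cst)·(a·CQH)·L^{−k}`, NO hypothesis.  NOT (CONV-C). [folklore] -/
theorem V₄_col_succ_sub_le_all (c : Fin (d + 1) → Fin (d + 1) → Fin (d + 1) → Fin (d + 1) → ℂ) (p q r o : idx L M 0) (k : ℕ) :
    ‖V₄ L (k + 1) c (colS L M a ha k p) (colS L M a ha k q) (colS L M a ha k r) (colS L M a ha k o)
        - V₄ L k c (col L M a ha k p) (col L M a ha k q) (col L M a ha k r) (col L M a ha k o)‖
      ≤ 4 * (cnorm₄ c * (KH d * KH d * ((a * Cst (d + 1) a) * (a * CQH (d + 1) a * ((L : ℝ)⁻¹) ^ k)))) :=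
  V₄_col_succ_sub_le L M a ha (KH_nonneg d) (sqrt_mul_norm_Mtil_le L M a ha) c p q r o k

end AllA

/-! ## §4 The gradient-vertex junction for p3-g25's PART 7 (`SoftColumnGradVertexRate`, p262097) -/

section GradJunction

variable (L : ℕ) [NeZero L] (M : Fin (d + 1) → ℕ) [hM : ∀ μ, NeZero (M μ)] (a : ℝ) (ha : 0 < a)

/-- **R7's GRADIENT THREE-COLUMN VERTEX CHAIN FOR EVERY `a > 0` — UNCONDITIONAL**: `SoftColumnGradVertexRate.V₃_gradcol_succ_sub_le`
(p3-g25 PART 7, one differentiated leg `∇_νM̃e_p`, «under the ZEROTH-order letter `hcol` ONLY») with `hcol := sqrt_mul_norm_Mtil_le`: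
`≤ (2 + 2√L)·‖Cf‖₁·KH(d)·(a·Cst)·(a·CQH)·L^{−k}`, NO hypothesis.  NOT (CONV-C). [folklore] -/
theorem V₃_gradcol_succ_sub_le_all (Cf : Fin (d + 1) → Fin (d + 1) → Fin (d + 1) → ℂ) (ν : Fin (d + 1))
    (p q r : idx L M 0) (k : ℕ) :
    ‖V₃ L (k + 1) Cf (fdS L M k ν *ᵥ colS L M a ha k p) (colS L M a ha k q) (colS L M a ha k r)
        - V₃ L k Cf (fd L M k ν *ᵥ col L M a ha k p) (col L M a ha k q) (col L M a ha k r)‖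
      ≤ (2 + 2 * Real.sqrt L) * (cnorm₃ Cf * (KH d * ((a * Cst (d + 1) a) * (a * CQH (d + 1) a * ((L : ℝ)⁻¹) ^ k)))) :=
  V₃_gradcol_succ_sub_le L M a ha (KH_nonneg d) (sqrt_mul_norm_Mtil_le L M a ha) Cf ν p q r k

end GradJunction

end Summit.QuantumFields.BalabanUV.Beta.GAN24.SoftColumnSupLetter

end
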